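import Literature.AnabelianGeometry.SemiGraphs.TemperedCompactInVerticialOfOneChart
import Literature.AnabelianGeometry.SemiGraphs.TemperedMaximalCompact
import Literature.AnabelianGeometry.SemiGraphs.TemperedEdgeLikeDistinct
import HarnessLib

/-!
# [SemiAnbd] Thm 3.7 (iii)/(iv) and (ii)-for-edges AT ONE GRAPH: the per-graph predicates (cell ruling φ2 / α4-3)

Mochizuki, *Semi-graphs of anabelioids*, Publ. RIMS **42** (2006), §3, Theorem 3.7 (iii), (iv),
manuscript pp. 40–41 [cite: MochizukiSemiAnbd2006, Thm 3.7(iii)(iv) pp.40-41] ("Since the semi-graphs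
`𝔾_j` are all finite …" — print's proof of (iii) covers FINITE `𝔾`; tree-health RQ21, cell ruling φ2).

DEFINITION file (abc-iut cell wave-4 seat abc-iut-w4-d075, L3-lead ruling α4-3 «φ2-CONSUMERS, OPTION (A) +
BRIDGE»).  The frozen named facts `CompactInVerticial`, `MaximalCompactIffVerticial`,
`EdgeLikeIsInfVerticial`, `EdgeLikeDistinct` (`TemperedVerticial.lean`, `TemperedMaximalCompact.lean`,
`TemperedEdgeLikeDistinct.lean`) quantify over ALL countable `𝒢`; the programme discharges Thm 3.7 (iii)
only for finite `𝔾` (`FiniteLevelData.compactInVerticial_of_finite`, abc-iut-L3-t10).  Here each of the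
four is restated AT ONE GRAPH `𝒢` — the BODY of the frozen def with its leading `∀ 𝒢` removed and every
other binder (including `𝒢.Thm37Hypotheses →`) kept verbatim — so that the frozen fact is DEFINITIONALLY
`∀ 𝒢, …At 𝒢` (`…_iff_forall_at : … := Iff.rfl`), consumers can take `(h : CompactInVerticialAt 𝒢)` and port
their proofs by `hCV 𝒢 ↦ h`; the old⇒new specialisations and the BRIDGE from the finite-`𝔾` producer
(`compactInVerticialAt_of_finiteLevelData`) are in the proof-only companion
`TemperedCompactInVerticialAtBridge.lean`.  Frozen files
untouched; nothing here asserts Thm 3.7 (iii) for an infinite `𝔾`. Nothing here bears on [IUTchIII] Cor. 3.12.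
-/

namespace Literature.AnabelianGeometry.SemiGraphs

namespace ProfiniteSemiGraph

open Topology

universe v u

/-- **Thm 3.7 (iii) AT the graph `𝒢`** — the body of the frozen named fact `CompactInVerticial` at one `𝒢`
(same binders: the hypotheses of Thm 3.7, a chart `c`, a compact `C ≤ π₁^temp(𝒢)`): `C` lies in a verticial
subgroup; if `C ≠ 1` lies in two distinct verticial subgroups then in no third one, and then in an edge-like
subgroup of a closed edge. [cite: MochizukiSemiAnbd2006, Thm 3.7(iii) pp.40-41] -/
def CompactInVerticialAt (𝒢 : ProfiniteSemiGraph.{u}) : Prop :=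
  𝒢.Thm37Hypotheses → ∀ (c : TemperedPiChart 𝒢) (C : Subgroup c.G), IsCompact (C : Set c.G) →
    (∃ (v : 𝒢.graph.Vertex) (H : Subgroup c.G), H ∈ verticialSubgroups c v ∧ C ≤ H) ∧
      (C ≠ ⊥ → ∀ (v₁ v₂ : 𝒢.graph.Vertex) (H₁ H₂ : Subgroup c.G), H₁ ∈ verticialSubgroups c v₁ →
        H₂ ∈ verticialSubgroups c v₂ → H₁ ≠ H₂ → C ≤ H₁ → C ≤ H₂ →
          (∀ (v₃ : 𝒢.graph.Vertex) (H₃ : Subgroup c.G), H₃ ∈ verticialSubgroups c v₃ → C ≤ H₃ →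
              H₃ = H₁ ∨ H₃ = H₂) ∧
          ∃ (e : 𝒢.graph.Edge) (L : Subgroup c.G), 𝒢.graph.IsClosedEdge e ∧
            L ∈ edgeLikeSubgroups c e ∧ C ≤ L)

/-- **Thm 3.7 (iv) AT the graph `𝒢`** — the body of the frozen `MaximalCompactIffVerticial` at one `𝒢`:
maximal compact ⇔ verticial, and the nontrivial intersections of two distinct maximal compact subgroups
are exactly the edge-like subgroups of closed edges. [cite: MochizukiSemiAnbd2006, Thm 3.7(iv) p.41] -/
def MaximalCompactIffVerticialAt (𝒢 : ProfiniteSemiGraph.{u}) : Prop :=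
  𝒢.Thm37Hypotheses → ∀ (c : TemperedPiChart 𝒢),
    (∀ K : Subgroup c.G, IsMaximalCompactSubgroup K ↔ ∃ v, K ∈ verticialSubgroups c v) ∧
    ∀ L : Subgroup c.G, L ≠ ⊥ →
      ((∃ K₁ K₂ : Subgroup c.G, IsMaximalCompactSubgroup K₁ ∧ IsMaximalCompactSubgroup K₂ ∧
          K₁ ≠ K₂ ∧ L = K₁ ⊓ K₂) ↔ ∃ e, 𝒢.graph.IsClosedEdge e ∧ L ∈ edgeLikeSubgroups c e)

/-- **The rung-4 residual `EdgeLikeIsInfVerticial` AT the graph `𝒢`**: every nontrivial edge-like subgroup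
of a closed edge is the intersection of two distinct verticial subgroups.
[cite: MochizukiSemiAnbd2006, Thm 3.7(iv) p.41] -/
def EdgeLikeIsInfVerticialAt (𝒢 : ProfiniteSemiGraph.{u}) : Prop :=
  𝒢.Thm37Hypotheses → ∀ (c : TemperedPiChart 𝒢) (e : 𝒢.graph.Edge),
    𝒢.graph.IsClosedEdge e → ∀ L ∈ edgeLikeSubgroups c e, L ≠ ⊥ →
      ∃ (v₁ v₂ : 𝒢.graph.Vertex) (H₁ H₂ : Subgroup c.G), H₁ ∈ verticialSubgroups c v₁ ∧
        H₂ ∈ verticialSubgroups c v₂ ∧ H₁ ≠ H₂ ∧ L = H₁ ⊓ H₂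

/-- **Thm 3.7 (ii), edge form (`EdgeLikeDistinct`) AT the graph `𝒢`**: edge-like subgroups of distinct
edges have infinite mutual index (`L₂.relIndex L₁ = 0`). [cite: MochizukiSemiAnbd2006, Thm 3.7(ii)(iv) pp.40-41] -/
def EdgeLikeDistinctAt (𝒢 : ProfiniteSemiGraph.{u}) : Prop :=
  𝒢.Thm37Hypotheses → ∀ (c : TemperedPiChart 𝒢) (e₁ e₂ : 𝒢.graph.Edge) (L₁ L₂ : Subgroup c.G),
    L₁ ∈ edgeLikeSubgroups c e₁ → L₂ ∈ edgeLikeSubgroups c e₂ → e₁ ≠ e₂ → L₂.relIndex L₁ = 0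

/-! ### The frozen facts are definitionally `∀ 𝒢, …At 𝒢` -/

/-- `CompactInVerticial` is, definitionally, `CompactInVerticialAt` at every `𝒢`.
[cite: MochizukiSemiAnbd2006, Thm 3.7(iii) pp.40-41] -/
theorem compactInVerticial_iff_forall_at :
    CompactInVerticial.{u} ↔ ∀ 𝒢 : ProfiniteSemiGraph.{u}, CompactInVerticialAt 𝒢 := Iff.rfl

/-- `MaximalCompactIffVerticial` is, definitionally, `MaximalCompactIffVerticialAt` at every `𝒢`.
[cite: MochizukiSemiAnbd2006, Thm 3.7(iv) p.41] -/
theorem maximalCompactIffVerticial_iff_forall_at :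
    MaximalCompactIffVerticial.{u} ↔ ∀ 𝒢 : ProfiniteSemiGraph.{u}, MaximalCompactIffVerticialAt 𝒢 := Iff.rfl

/-- `EdgeLikeIsInfVerticial` is, definitionally, `EdgeLikeIsInfVerticialAt` at every `𝒢`.
[cite: MochizukiSemiAnbd2006, Thm 3.7(iv) p.41] -/
theorem edgeLikeIsInfVerticial_iff_forall_at :
    EdgeLikeIsInfVerticial.{u} ↔ ∀ 𝒢 : ProfiniteSemiGraph.{u}, EdgeLikeIsInfVerticialAt 𝒢 := Iff.rfl

/-- `EdgeLikeDistinct` is, definitionally, `EdgeLikeDistinctAt` at every `𝒢`.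
[cite: MochizukiSemiAnbd2006, Thm 3.7(ii)(iv) pp.40-41] -/
theorem edgeLikeDistinct_iff_forall_at :
    EdgeLikeDistinct.{u} ↔ ∀ 𝒢 : ProfiniteSemiGraph.{u}, EdgeLikeDistinctAt 𝒢 := Iff.rfl

end ProfiniteSemiGraph

end Literature.AnabelianGeometry.SemiGraphs
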